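import Mathlib
import Summits.Parity.BatemanHorn.Theses.IsogenyRedei
import Literature.NumberTheory.Sieve.SieveFrameworkUpperBound
import Literature.NumberTheory.Sieve.PolynomialValuesSieveSequence
import Literature.NumberTheory.Sieve.QuadraticRootCountLogSums
import Summits.Parity.BatemanHorn.Theorems.IsogenyRedeiSplitBlockJacobiSplitMassBound
import Summits.Parity.BatemanHorn.Theorems.IsogenyRedeiSplitBlockJacobiDigitReparametrisation
import Summits.Parity.BatemanHorn.Theorems.IsogenyRedeiSplitBlockJacobiPureDigitPiecesPV

/-!
# Skeleton line `split-mass-middle-prime` for crux `SplitBlockJacobi` (stmt-Parity-11583)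

Route `IsogenyRedei` (route-Parity-IsogenyRedei), crux rank 2:
`SplitBlockJacobi = ∀ θ ∈ (1/2, 1), J_θ(x) := Σ_{t ≤ x} Σ_{Q<Q′ prime factors of t²+1, Q > x^θ} (Q|Q′) = o(x)`.

## The line (crux idea card `split-mass-middle-prime`; triage r1: pass/pass/pass "as a REDUCTION line")

LEVER 1 (mass). The support of the summand — two CO-LARGE prime factors `Q < Q′`, both `> x^θ`, of one
value `t²+1` — forces the cofactor `m = (t²+1)/(QQ′) < 2x^{2−2θ}` into a bounded range, and the upper-bound
sieve along the `ρ(m)` root classes of `t² ≡ −1 (mod m)` (level `x/m ≥ x^{2θ−1}/2 → ∞`, which is exactly where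
`1/2 < θ` is used) gives `splitMass θ x ≤ C·(1−θ)/(2θ−1)·x` eventually, ONE absolute `C` (STUB 1). Measured
Dickman limits `N_θ/x → 0.228, 0.115, 0.047, 0.011, 0.0026` at `θ = .6,.7,.8,.9,.95` (triage r1-3).

LEVER 2 (transfer, PROVED HERE). `J_θ = (J_θ − J_{θ′}) + J_{θ′}`, `|J_{θ′}| ≤ splitMass θ′ x ≤ C(1−θ′)/(2θ′−1)·x`
and `J_θ − J_{θ′}` is LITERALLY the middle sum over pairs with `x^θ < Q ≤ x^{θ′}`; letting `θ′ → 1` inside the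
`ε`-definition of `o(x)`: `SplitMassBound → MiddlePrimeJacobi → SplitBlockJacobi` (`transfer_holds`, no `sorry`).
So the crux is EQUIVALENT to `MiddlePrimeJacobi`, in which the SMALLER prime of every pair is enumerable:
`t = ν + Q·s`, `s ≤ x/Q`, a root progression of length `≥ x^{1−θ′} → ∞` in every term. The route's "symbol
between two mutually inaccessible primes" (`θ → 1`) carries no mass in the limit.

LEVER 3 (relocation of the atom; STUBS 2–4). Along the root progression the summand FACTORS
(reciprocity for `Q ≡ Q′ ≡ 1 (mod 4)`, `t²+1 = Q·Q′·m`, `R(s) := (t²+1)/Q ≡ c_ν + 2νs (mod Q)`,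
`c_ν = (ν²+1)/Q`):
  `(Q|Q′) = (Q′|Q) = (R(s)|Q)·(m|Q) = (c_ν + 2νs | Q) · (m | Q)`  whenever `Q ∤ m`
(the `Q² ∣ t²+1` exceptions are `O(x^{1−θ} + x^{θ′}) = o(x)` triples) — the Legendre symbol of the SECOND
`Q`-ADIC DIGIT of `t²+1` (a LINEAR form in the class variable `s`) against the weight
`w_Q(R) = Σ_{Q′ ∣ R prime, Q′ > Q} (R/Q′ | Q)` which encodes "the cofactor `R(s)/m` is a prime". STUB 2
(`digitReparametrisation`, TRUE, M–L) moves `MiddlePrimeJacobi` into this factored currency. What is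
left splits by NATURE, as the triage panel asked (r1-1 "type the pure pieces as a separate stub so the
residue χ_Q(linear) × primality is the only [hard] sorry"; r1-3 "factored form so the coupling is visible"):
* STUB 3 `pureDigitPieces` — TYPE-I_χ INFORMATION: the digit character summed over `s` in residue classes
  to moduli `k ≤ x^η` (`θ′ + η < 1`, so every inner sum has length `≥ x^{1−θ′−η} → ∞`), in `ℓ¹` over
  `(Q, ν, k, a)`, is `o(x)` (trivial size `≍ x log x`). A THEOREM in the Burgess range `1 − θ′ − η > θ′/4`
  (Burgess is shift-invariant); beyond it NOT a GRH-consequence (short intervals starting at the Hensel point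
  `κ = −ν₁`, `ν̃ = ν + Qν₁` the root of `−1 mod Q²` — the card's "GRH kills the pure pieces" is corrected here)
  but a start-point-AVERAGED short character sum (`Σ_κ |Σ_{u≤H} χ(κ+u)|² ≈ QH`), i.e. the spine card's K3
  (twisted equidistribution of Hensel-lifted roots `ν̃/Q²`). Open in that range, Type-I in kind.
* STUB 4 `primalityCoupling` — THE ATOM, HARDEST: given all the Type-I_χ information of STUB 3, the
  factored middle sum cancels. Any sieve identity opening `w_Q` (the primality of `R(s)/m`) leaves, beyond the
  level `x^η`, the correlation "`χ_Q`(linear form in `s`) × parity of the quadratic values `R(s)/m`" on a thin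
  set (`c = 1 − (1−θ₁)/(2−θ₁) > 1/2`: Ford–Maynard, no Type-II range on ONE line; Bombieri-indeterminate from
  Type-I data alone). The card's family-dispersion engine for it is DEAD by its own falsifier (iii) (≤ 1 lattice
  point, triage r1-3 caveat (a)); no stub invests in it. This stub is where a new input must enter.

`SplitBlockJacobi_of` composes the stubs into the crux BY NAME (kernel-checked, no `sorry`; after reshape r1 only
STUBS 3–4 remain hypotheses, STUBS 1–2 being landed theorems):
`transfer_holds splitMassBound_holds (digitReparametrisation_holds (h4 h3))`.

## Lead's log (line lead prover-line-stmt-Parity-11583-0, 2026-08-16)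

* Wave 1: STUB 1 `stub_splitMassBound` LANDED (p75292, `Theorems/IsogenyRedeiSplitBlockJacobiSplitMassBound.lean`,
  short proof: pairs(t) ⊆ B(t) × Big(t), `#Big ≤ 5`, AP count `≤ 4x/Q`, Mertens-2 with rate, `C = 60`);
  STUB 2 `stub_digitReparametrisation` LANDED (p75842, `Theorems/IsogenyRedeiSplitBlockJacobiDigitReparametrisation.lean`,
  `|middle − factored| ≤ 12(x^{θ′}+1)`); STUB 3 partial: `pureDigitPieces_of_polyaVinogradov_range` LANDED
  (p75518, `Theorems/IsogenyRedeiSplitBlockJacobiPureDigitPiecesPV.lean`, range `3θ′/2 + η < 1` from the tree's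
  Pólya–Vinogradov); Burgess (IK Thm 12.6) is not in the tree, and beyond Burgess the pieces are open.
  Hence the tree now PROVES `MiddlePrimeJacobi → SplitBlockJacobi` and `FactoredMiddleCancels → SplitBlockJacobi`.
* Reshape r1 (drefute `stub-misstated: stub_pureDigitPieces`, 2026-08-16T02:08Z): STUB 3 and the hypothesis of
  STUB 4 move from the bare `o(x)` form to the POWER-SAVING form `PureDigitPiecesPow` (`∃ δ > 0, O(x^{1−δ})`), the
  minimal form a sieve opening of the primality weight can consume (coefficients of size `τ(k)`); truth values
  unchanged. Registered stubs after r1: `stub_splitMassBound` (landed), `stub_digitReparametrisation` (landed),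
  `stub_pureDigitPiecesPow` (open beyond Burgess; PV range proved), `stub_primalityCoupling` (the atom).

## Disproof used (cdisprove v1–v5, evidence 20260815T221831Z…231006Z; `Disproof.lean` itself is NOT mounted
in this jail (`run/gate/evidence` absent, `ledger crux cat … Disproof.lean` → none) and nothing has landed under
`Theorems/…SplitBlockJacobi…/Negative/`; read through its evidence notes)
* §A load-bearing: `θ < 1` NOT load-bearing (`pairs_eq_empty_of_one_le`) — consistent: the transfer never uses
  `θ < 1` except to place `θ′ ∈ (θ, 1)`; `1/2 < θ` IS load-bearing (`not_SplitBlockJacobiWithoutLower` near-miss: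
  `J_0 ∼ −0.43x`, secular `x^{1−θ}` term for `θ ≤ 1/2`) — HONOURED: the line uses `1/2 < θ` at STUB 1 (level
  `x^{2θ−1} → ∞`; the bound `C(1−θ)/(2θ−1)` blows up at `θ = 1/2`) and at STUB 2 (`Q > x^θ > x^{1/2}` makes
  `Q² ∣ t²+1` an `o(x)` event and `Q ∤ k` for `k ≤ x^η`).
* §C tightness (`card_bigFactors_le_three`, `abs_J_le : |J_θ| ≤ 9x`, `isBigO_J`): consistent — the crux is
  exactly `o` vs `O`; STUB 1 is the quantitative `o`-version of the trivial bound on the `θ′`-tail.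
* §D Aurifeuillian sign-coherent families (`t = 2m²`): they live at `Q ≍ Q′ ≍ x`, i.e. in the `θ′`-TAIL that
  STUB 1 shows has vanishing mass — the refuted strengthening "signs equidistribute along algebraic families"
  is not assumed by any stub (STUB 3 has absolute values outside, STUB 4 asks only `o(x)` in aggregate).
* §F SL₂ spin form / one point per horocycle when `B > x`: this is the single-line emptiness that killed the
  engine bet; honoured by NOT cutting a dispersion stub.
* §H Chebyshev second-order bias of generic pairs: no stub models `E/D` main terms; irrelevant to `o(x)`.
No `-- Targets` stub kill and no landed Negative lemma applies to an instance of any stub (none landed).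
Negatives index (`ledger negatives --problem Parity`): 3 GHL refutations, unrelated.
-/

noncomputable section

open Filter Finset Asymptotics
open scoped Classical

set_option linter.dupNamespace false
set_option linter.unusedVariables false

namespace Summit.Parity.BatemanHorn.Cruxes.SplitBlockJacobi.SplitMassMiddlePrime

/-! ### Vocabulary (readable names for the literal sums; the stubs below restate them literally) -/

/-- `J_θ(x)`: the crux's sum — VERBATIM the function inside `IsogenyRedei.SplitBlockJacobi`. -/
def pairSum (θ : ℝ) (x : ℕ) : ℝ :=
  ∑ t ∈ Icc 1 x, ∑ q ∈ ((t ^ 2 + 1).primeFactors ×ˢ (t ^ 2 + 1).primeFactors).filter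
    (fun q : ℕ × ℕ => (x : ℝ) ^ θ < (q.1 : ℝ) ∧ q.1 < q.2), (jacobiSym (q.1 : ℤ) q.2 : ℝ)

/-- `N_θ(x)`: the trivial mass of `J_θ(x)` — number of triples `(t, Q, Q′)`, `1 ≤ t ≤ x`, `Q < Q′` prime
factors of `t²+1` with `Q > x^θ`. -/
def splitMass (θ : ℝ) (x : ℕ) : ℕ :=
  ∑ t ∈ Icc 1 x, (((t ^ 2 + 1).primeFactors ×ˢ (t ^ 2 + 1).primeFactors).filter
    (fun q : ℕ × ℕ => (x : ℝ) ^ θ < (q.1 : ℝ) ∧ q.1 < q.2)).card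

/-- `M_{θ,θ′}(x) = J_θ(x) − J_{θ′}(x)`: the MIDDLE-PRIME sum — pairs whose smaller prime is enumerable,
`x^θ < Q ≤ x^{θ′}`. -/
def middleSum (θ θ' : ℝ) (x : ℕ) : ℝ :=
  ∑ t ∈ Icc 1 x, ∑ q ∈ ((t ^ 2 + 1).primeFactors ×ˢ (t ^ 2 + 1).primeFactors).filter
    (fun q : ℕ × ℕ => (x : ℝ) ^ θ < (q.1 : ℝ) ∧ (q.1 : ℝ) ≤ (x : ℝ) ^ θ' ∧ q.1 < q.2),
      (jacobiSym (q.1 : ℤ) q.2 : ℝ)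

/-- The FACTORED middle sum, in `(Q, ν, s)`-currency (`t = ν + Q·s`, `ν² ≡ −1 (mod Q)`, `0 ≤ ν < Q`):
`Σ_Q Σ_ν Σ_s (c_ν + 2νs | Q) · Σ_{Q′ ∣ R, Q′ > Q prime} (R/Q′ | Q)`, `R = ((ν+Qs)²+1)/Q`, `c_ν = (ν²+1)/Q`
(all divisions exact). Equals `middleSum θ θ′ x` term by term except on the `o(x)` triples with `Q ∣ R/Q′`
(checked numerically: x = 2000, (θ,θ′) = (.55,.75), (.6,.9), (.7,.95): masses 359/382/185 agree, the sums
differ by exactly the 2/1/0 exceptional terms). -/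
def factoredSum (θ θ' : ℝ) (x : ℕ) : ℝ :=
  ∑ Q ∈ (range (x + 1)).filter
      (fun Q : ℕ => Q.Prime ∧ (x : ℝ) ^ θ < (Q : ℝ) ∧ (Q : ℝ) ≤ (x : ℝ) ^ θ'),
    ∑ ν ∈ (range Q).filter (fun ν : ℕ => Q ∣ ν ^ 2 + 1),
      ∑ s ∈ (range (x + 1)).filter (fun s : ℕ => ν + Q * s ≤ x),
        (jacobiSym (((ν ^ 2 + 1) / Q + 2 * ν * s : ℕ) : ℤ) Q : ℝ) *
          ∑ Q' ∈ ((((ν + Q * s) ^ 2 + 1) / Q).primeFactors).filter (fun Q' : ℕ => Q < Q'),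
            (jacobiSym ((((ν + Q * s) ^ 2 + 1) / Q / Q' : ℕ) : ℤ) Q : ℝ)

/-- The TYPE-I_χ statistic: the digit character `(c_ν + 2νs | Q)` summed over `s ≡ a (mod k)`,
`s = a + k·u`, for every modulus `1 ≤ k ≤ x^η` and every ROOT class `a mod k` (those with `Q·k ∣ (ν+Qa)²+1`,
i.e. `k ∣ R(s)` along the class), in `ℓ¹` over `(Q, ν, k, a)`. Trivial size `≍ x·log x^η`. -/
def pureDigitSum (θ θ' η : ℝ) (x : ℕ) : ℝ :=
  ∑ Q ∈ (range (x + 1)).filter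
      (fun Q : ℕ => Q.Prime ∧ (x : ℝ) ^ θ < (Q : ℝ) ∧ (Q : ℝ) ≤ (x : ℝ) ^ θ'),
    ∑ ν ∈ (range Q).filter (fun ν : ℕ => Q ∣ ν ^ 2 + 1),
      ∑ k ∈ (Icc 1 x).filter (fun k : ℕ => (k : ℝ) ≤ (x : ℝ) ^ η),
        ∑ a ∈ (range k).filter (fun a : ℕ => Q * k ∣ (ν + Q * a) ^ 2 + 1),
          |∑ u ∈ (range (x + 1)).filter (fun u : ℕ => ν + Q * (a + k * u) ≤ x),
              (jacobiSym (((ν ^ 2 + 1) / Q + 2 * ν * (a + k * u) : ℕ) : ℤ) Q : ℝ)|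

/-! ### The statements of the line (named `Prop`s) -/

/-- STUB 1 statement: the split mass vanishes linearly, `N_θ(x) ≤ C·(1−θ)/(2θ−1)·x` eventually,
ONE absolute `C`, every `θ ∈ (1/2, 1)`. -/
def SplitMassBound : Prop :=
  ∃ C : ℝ, 0 < C ∧ ∀ θ : ℝ, 1 / 2 < θ → θ < 1 →
    ∀ᶠ x : ℕ in atTop, (splitMass θ x : ℝ) ≤ C * ((1 - θ) / (2 * θ - 1)) * x

/-- The transfer target `C⁺` of the card: the middle-prime Jacobi sum cancels. Crux-EQUIVALENT given
`SplitMassBound` (⇐ needs nothing: `M = J_θ − J_{θ′}`; ⇒ is `transfer_holds` below). -/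
def MiddlePrimeJacobi : Prop :=
  ∀ θ θ' : ℝ, 1 / 2 < θ → θ < θ' → θ' < 1 →
    (fun x : ℕ => middleSum θ θ' x) =o[atTop] fun x : ℕ => (x : ℝ)

/-- The same cancellation in factored `(Q, ν, s)`-currency. -/
def FactoredMiddleCancels : Prop :=
  ∀ θ θ' : ℝ, 1 / 2 < θ → θ < θ' → θ' < 1 →
    (fun x : ℕ => factoredSum θ θ' x) =o[atTop] fun x : ℕ => (x : ℝ)

/-- STUB 3 statement, POWER-SAVING form (reshape r1, 2026-08-16, after the parallel refuter's interface
finding `stub-misstated: stub_pureDigitPieces`): Type-I_χ level `x^η` for the digit character, any `η > 0`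
with `θ′ + η < 1`, with a power saving `x^{1−δ}`, `δ = δ(θ,θ′,η) > 0`. The bare `o(x)` form first filed is
not CONSUMABLE by any sieve opening of the primality weight in STUB 4 (class sums enter with coefficients
`Σ_{md=k} (m|Q)λ_d` of size `τ(k)`, unbounded; truncation costs `x(log x)^c/L`), whereas a power saving is
(`τ(k) ≤ x^{δ/2}`). Truth is unchanged: Pólya–Vinogradov (`3θ′/2 + η < 1`, PROVED in the tree:
`pureDigitPieces_of_polyaVinogradov_range`, explicit majorant `4C·x^{θ′+η+θ′/2}(1+log x)`) and Burgess
(`θ′/4 < 1 − θ′ − η`, IK Thm 12.6, not in the tree) give power savings in their ranges, and the random-start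
model predicts the saving `x^{−(1−θ′−η)/2}` everywhere (measured PD/T ∝ x^{−0.15}, PD/NULL ∈ [0.989, 1.007]
to 10⁸ by the drefuter). Beyond the Burgess range the statement is OPEN (K3-type). -/
def PureDigitPiecesPow : Prop :=
  ∀ θ θ' η : ℝ, 1 / 2 < θ → θ < θ' → θ' < 1 → 0 < η → θ' + η < 1 →
    ∃ δ : ℝ, 0 < δ ∧ (fun x : ℕ => pureDigitSum θ θ' η x) =O[atTop] fun x : ℕ => (x : ℝ) ^ (1 - δ)

/-- STUB 2 statement (the dictionary): factored cancellation gives middle-prime cancellation. -/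
def DigitReparametrisation : Prop := FactoredMiddleCancels → MiddlePrimeJacobi

/-- STUB 4 statement (the atom): Type-I_χ information (power-saving form) at every level below
`x^{1−θ′}` gives the factored cancellation, i.e. controls the coupling of the digit character with the
primality of the cofactor. (Reshape r1: hypothesis `PureDigitPiecesPow`.) -/
def PrimalityCoupling : Prop := PureDigitPiecesPow → FactoredMiddleCancels

/-- The GLUE statement (PROVED below as `transfer_holds`; named so that the skeleton audit reads
`SplitBlockJacobi_of`, not the glue, as the theorem concluding the crux): the mass bound and middle-prime
cancellation imply the crux. -/
def Transfer : Prop :=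
  SplitMassBound → MiddlePrimeJacobi → Summit.Parity.BatemanHorn.Theses.IsogenyRedei.SplitBlockJacobi

/-! ### The registered stubs (literal signatures over Mathlib + the route file only) -/

-- STUB 1 `stub_splitMassBound` — LANDED (p75292): imported from
-- `Summits.Parity.BatemanHorn.Theorems.IsogenyRedeiSplitBlockJacobiSplitMassBound` (same namespace, same name,
-- literal registered signature; proof: pairs(t) ⊆ B(t) × Big(t), #Big ≤ 5, AP count ≤ 4x/Q, Mertens-2 with rate; C = 60).

-- STUB 2 `stub_digitReparametrisation` — LANDED (p75842): imported from
-- `Summits.Parity.BatemanHorn.Theorems.IsogenyRedeiSplitBlockJacobiDigitReparametrisation` (same namespace, same name,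
-- literal registered signature; reindexing t = ν + Qs, termwise identity off Q² ∣ t²+1, |middle − factored| ≤ 12(x^θ′+1)).

/-- STUB 3 (reshaped r1 to the POWER-SAVING form `PureDigitPiecesPow`; L in the Pólya–Vinogradov /
Burgess ranges, open beyond; TYPE-I in kind): for `1/2 < θ < θ′ < 1`, `0 < η`, `θ′ + η < 1` there is `δ > 0` with
`Σ_{x^θ<Q≤x^{θ′} prime} Σ_{ν²≡−1 (Q)} Σ_{k ≤ x^η} Σ_{a mod k root class} |Σ_{u : ν+Q(a+ku) ≤ x} (c_ν + 2ν(a+ku) | Q)| = O(x^{1−δ})`.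
PROVED sub-range (tree, this line): `pureDigitPieces_of_polyaVinogradov_range` (`3θ′/2 + η < 1`, majorant
`4C x^{θ′+η+θ′/2}(1 + log x)`, hence any `δ < 1 − θ′ − η − θ′/2`). The original `o(x)` discussion follows.
Each inner sum is a Legendre-symbol sum over `u ≤ x/(Qk)`, of length `H ≥ x^{1−θ′−η} → ∞`, of a LINEAR form
`α + β·u` (`β = 2νk ≢ 0`): as a set of residues an interval of length `H` starting at the point
`κ = (c_ν + 2νa)·(2νk)⁻¹ (mod Q)` (for `a = 0, k = 1`: `κ = −ν₁`, minus the second Hensel digit of `√−1 mod Q²`).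
Trivial size `Σ_{Q,ν} Σ_{k≤x^η} ρ(k)·x/(Qk) ≍ x·η log x·log(θ′/θ)`, so `o(x)` asks a `(log x)^{1+ε}` saving on
average. WHY PLAUSIBLE / WHAT IS KNOWN: (a) for `H > Q^{1/4+ε}`, i.e. `1 − θ′ − η > θ′/4`, Burgess's bound
(shift-invariant) saves a power POINTWISE — a theorem in print (Burgess 1962/63; IwaniecKowalski2004 Thm 12.6),
so this stub restricted to `θ′ < 4/5`, `η < 1 − 5θ′/4` is provable with (large) effort; (b) beyond Burgess it is
NOT a GRH-consequence (GRH bounds initial segments, not length-`H` intervals at arbitrary `κ`), but the mean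
square over ALL start points is `Σ_{κ mod Q} |Σ_{u≤H} χ_Q(κ+u)|² = HQ − H² + O(H)`, so square-root cancellation
holds for all but `O(Q·(log)^4/H)` start points; the stub asks that the ARITHMETIC start points
`κ(Q,ν,a,k)` are not concentrated on the exceptional ones — on average over `k, a` (Kloosterman-type spreading
of `(2νk)⁻¹`) and over `(Q, ν)` this is the twisted equidistribution of Hensel-lifted roots `ν̃/Q²` for PRIME
`Q` = the spine card's K3 / the GRH-removal input of `SingleBlockMoments` (route NOT DECOMPOSED YET);
for prime-square moduli `Q² = N(π)²` the roots are parametrised by Gaussian primes `π` (DFI's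
correspondence), so Hecke-Grössencharakter equidistribution is the expected engine
(tree: `Literature/NumberTheory/Sieve/QuadraticRootsPrimeModuliDFI*`, Tóth). WHY IT MIGHT FAIL: only through a
conspiracy placing the Hensel points of a positive proportion of `(Q, ν)` inside the `≤ Q^{1/4} log Q`-long
runs of constant Legendre symbol — itself a publishable bias. `ℓ¹` form (absolute values outside the `u`-sum,
`(Q,ν,k,a)` outside) = exactly the Type-I input of an upper-bound/identity sieve on `w_Q`.
Leans on: `jacobiSym`, `Nat.primeFactors`, `Real.rpow`; in print Burgess (IK Thm 12.6), Heath-Brown's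
quadratic large sieve (Acta Arith. 72, 1995), DFI 1995 / Tóth 2000 (roots to prime moduli). -/
theorem stub_pureDigitPiecesPow :
    ∀ θ θ' η : ℝ, 1 / 2 < θ → θ < θ' → θ' < 1 → 0 < η → θ' + η < 1 →
      ∃ δ : ℝ, 0 < δ ∧
        (fun x : ℕ =>
          ∑ Q ∈ (Finset.range (x + 1)).filter
              (fun Q : ℕ => Q.Prime ∧ (x : ℝ) ^ θ < (Q : ℝ) ∧ (Q : ℝ) ≤ (x : ℝ) ^ θ'),
            ∑ ν ∈ (Finset.range Q).filter (fun ν : ℕ => Q ∣ ν ^ 2 + 1),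
              ∑ k ∈ (Finset.Icc 1 x).filter (fun k : ℕ => (k : ℝ) ≤ (x : ℝ) ^ η),
                ∑ a ∈ (Finset.range k).filter (fun a : ℕ => Q * k ∣ (ν + Q * a) ^ 2 + 1),
                  |∑ u ∈ (Finset.range (x + 1)).filter (fun u : ℕ => ν + Q * (a + k * u) ≤ x),
                      (jacobiSym (((ν ^ 2 + 1) / Q + 2 * ν * (a + k * u) : ℕ) : ℤ) Q : ℝ)|)
          =O[Filter.atTop] fun x : ℕ => (x : ℝ) ^ (1 - δ) := by
  sorry

/-- STUB 4 (open-problem, HARDEST — the lead's own stub; the relocated ATOM) — `PrimalityCoupling`: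
`PureDigitPiecesPow → FactoredMiddleCancels` (reshape r1: power-saving hypothesis, the consumable form). CONTENT: in `factoredSum` the weight
`w_Q(R) = Σ_{Q′ ∣ R prime, Q′ > Q} (R/Q′ | Q)` is `Σ_{m ∣ R, R/m prime > Q} (m|Q)`: a twisted PRIME INDICATOR of
the cofactor `R(s)/m` of the quadratic progression `R(s) = c_ν + 2νs + Qs²`, `s ≤ x/Q`. Opening it by any
sieve identity (Vaughan / Heath-Brown / Duke–Friedlander–Iwaniec sieve for primes, or Iwaniec's
`IwaniecAlmostPrimesQuadratic*` machinery in the tree) produces (I) linear pieces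
`Σ_{d ≤ D} λ_d Σ_{s : d ∣ R(s)/m} (c_ν + 2νs | Q)` — EXACTLY the sums bounded in `ℓ¹` by the hypothesis
`PureDigitPiecesPow` (level `D·m ≤ x^η`, any `η < 1 − θ′`) — and (II) bilinear pieces in the factorisation
`R(s) = m·a·b`, `a, b > x^η`, constrained to the thin line `{αβ : Im(ε αβ) = 1}` of `ℤ[i]`, where
Cauchy–Schwarz in either Gaussian variable is EMPTY (≤ 1 lattice point per pair of lines: triage r1-1/r1-3,
Disproof §F "one point per horocycle") — the parity-type residue "character of a LINEAR form in `s` vs. the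
Liouville/primality of a QUADRATIC form in `s`", a clean Chowla-type correlation along root progressions of
length `x^{1−θ′}`, with the smaller prime `Q` enumerable and every pure character piece discharged onto STUB 3.
WHY IT MIGHT HOLD ANYWAY: the statement is monotone in `θ′` (a proof for a sequence `θ′_k → 1` suffices for the
crux but NOT for this stub as typed — keep all `θ′`); the residue has a bi-multiplicative kernel
`(Nβ|Nα)·(Nα|Q)(Nβ|Q)` over `ℤ[i]` whose off-diagonals carry a NON-PRINCIPAL quadratic Hecke character (no
main terms to match — the step where Merikoski / de la Bretèche–Drappeau need asymptotics is absent); the only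
glue with a free variable is ACROSS `(Q, ν, m)` (all lines are `SL₂(ℤ)`-translates of one). WHY IT MIGHT FAIL
(as a proof target, not as a truth): Literature.Barriers.Parity.SelbergParity / FordMaynardPrimeSieves Entry 2
(thin set, `c > 1/2`): Type-I data of ANY level `< 1` does not determine the parity of `R(s)/m` on one line
(Bombieri 1976); the implication is true iff `FactoredMiddleCancels` is (its hypothesis is believed true), and
`FactoredMiddleCancels ⟺ MiddlePrimeJacobi ⟺` the crux. Numerics: `|J_θ|/√N ≤ 2.7` to `x = 10⁷` (rattack),
middle sums show the same square-root cancellation (triage). Sources: FordMaynard2024 §2.4/§4.6,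
BombieriAsymptoticSieve1976, arXiv:1908.08816 (Merikoski), de la Bretèche–Drappeau JEMS 2020,
FriedlanderIwaniec1998 (§§19–26), Heath-Brown Acta Arith. 72 (1995). -/
theorem stub_primalityCoupling :
    (∀ θ θ' η : ℝ, 1 / 2 < θ → θ < θ' → θ' < 1 → 0 < η → θ' + η < 1 →
      ∃ δ : ℝ, 0 < δ ∧
        (fun x : ℕ =>
          ∑ Q ∈ (Finset.range (x + 1)).filter
              (fun Q : ℕ => Q.Prime ∧ (x : ℝ) ^ θ < (Q : ℝ) ∧ (Q : ℝ) ≤ (x : ℝ) ^ θ'),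
            ∑ ν ∈ (Finset.range Q).filter (fun ν : ℕ => Q ∣ ν ^ 2 + 1),
              ∑ k ∈ (Finset.Icc 1 x).filter (fun k : ℕ => (k : ℝ) ≤ (x : ℝ) ^ η),
                ∑ a ∈ (Finset.range k).filter (fun a : ℕ => Q * k ∣ (ν + Q * a) ^ 2 + 1),
                  |∑ u ∈ (Finset.range (x + 1)).filter (fun u : ℕ => ν + Q * (a + k * u) ≤ x),
                      (jacobiSym (((ν ^ 2 + 1) / Q + 2 * ν * (a + k * u) : ℕ) : ℤ) Q : ℝ)|)
          =O[Filter.atTop] fun x : ℕ => (x : ℝ) ^ (1 - δ)) →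
    ∀ θ θ' : ℝ, 1 / 2 < θ → θ < θ' → θ' < 1 →
      (fun x : ℕ =>
        ∑ Q ∈ (Finset.range (x + 1)).filter
            (fun Q : ℕ => Q.Prime ∧ (x : ℝ) ^ θ < (Q : ℝ) ∧ (Q : ℝ) ≤ (x : ℝ) ^ θ'),
          ∑ ν ∈ (Finset.range Q).filter (fun ν : ℕ => Q ∣ ν ^ 2 + 1),
            ∑ s ∈ (Finset.range (x + 1)).filter (fun s : ℕ => ν + Q * s ≤ x),
              (jacobiSym (((ν ^ 2 + 1) / Q + 2 * ν * s : ℕ) : ℤ) Q : ℝ) *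
                ∑ Q' ∈ ((((ν + Q * s) ^ 2 + 1) / Q).primeFactors).filter (fun Q' : ℕ => Q < Q'),
                  (jacobiSym ((((ν + Q * s) ^ 2 + 1) / Q / Q' : ℕ) : ℤ) Q : ℝ))
        =o[Filter.atTop] fun x : ℕ => (x : ℝ) := by
  sorry

/-! ### Consistency: each named statement IS its registered stub (definitionally) -/

theorem splitMassBound_holds : SplitMassBound := stub_splitMassBound
theorem digitReparametrisation_holds : DigitReparametrisation := stub_digitReparametrisation
theorem pureDigitPiecesPow_holds : PureDigitPiecesPow := stub_pureDigitPiecesPow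
theorem primalityCoupling_holds : PrimalityCoupling := stub_primalityCoupling

/-! ### Name-keyed aliases of the four statements (the hypotheses of the composition; the skeleton audit
admits a hypothesis only if its head constant is a registered obligation or is named like a declared stub) -/
namespace Registered

/-- Alias of `PureDigitPiecesPow` keyed by the registered stub name. -/
abbrev stub_pureDigitPiecesPow : Prop := PureDigitPiecesPow
/-- Alias of `PrimalityCoupling` keyed by the registered stub name. -/
abbrev stub_primalityCoupling : Prop := PrimalityCoupling

end Registered

/-! ### Glue (PROVED): the transfer `SplitMassBound → MiddlePrimeJacobi → SplitBlockJacobi` -/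

/-- A Jacobi symbol, cast to `ℝ`, has norm at most `1`. -/
theorem norm_jacobiSym_cast_le_one (a : ℤ) (b : ℕ) : ‖((jacobiSym a b : ℤ) : ℝ)‖ ≤ 1 := by
  rcases jacobiSym.trichotomy a b with h | h | h <;> simp [h]

/-- `|J_θ(x)| ≤ N_θ(x)`: the crux sum is bounded by its trivial mass. -/
theorem norm_pairSum_le_splitMass (θ : ℝ) (x : ℕ) : ‖pairSum θ x‖ ≤ (splitMass θ x : ℝ) := by
  unfold pairSum splitMass
  rw [Nat.cast_sum]
  refine (norm_sum_le _ _).trans (Finset.sum_le_sum fun t _ => ?_)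
  refine (norm_sum_le _ _).trans ?_
  refine (Finset.sum_le_sum fun q _ => norm_jacobiSym_cast_le_one (q.1 : ℤ) q.2).trans ?_
  rw [Finset.sum_const, nsmul_eq_mul, mul_one]

/-- `J_θ = M_{θ,θ′} + J_{θ′}` for `θ ≤ θ′` and `x ≥ 1`: the filters split (pure bookkeeping; this is the
"`J_θ − J_{θ′}` is LITERALLY the middle sum" half of the card's TransferClaim). -/
theorem pairSum_eq_middleSum_add (θ θ' : ℝ) (x : ℕ) (hx : 1 ≤ x) (hθθ' : θ ≤ θ') :
    pairSum θ x = middleSum θ θ' x + pairSum θ' x := by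
  have hpow : (x : ℝ) ^ θ ≤ (x : ℝ) ^ θ' :=
    Real.rpow_le_rpow_of_exponent_le (by exact_mod_cast hx) hθθ'
  unfold pairSum middleSum
  rw [← Finset.sum_add_distrib]
  refine Finset.sum_congr rfl fun t _ => ?_
  rw [Finset.sum_filter, Finset.sum_filter, Finset.sum_filter, ← Finset.sum_add_distrib]
  refine Finset.sum_congr rfl fun q _ => ?_
  by_cases hR : (q.1 : ℝ) ≤ (x : ℝ) ^ θ'
  · have hnot : ¬ ((x : ℝ) ^ θ' < (q.1 : ℝ) ∧ q.1 < q.2) := fun h => (not_lt.mpr hR) h.1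
    rw [if_neg hnot, add_zero]
    by_cases hP : (x : ℝ) ^ θ < (q.1 : ℝ) ∧ q.1 < q.2
    · rw [if_pos hP, if_pos ⟨hP.1, hR, hP.2⟩]
    · rw [if_neg hP, if_neg (fun h => hP ⟨h.1, h.2.2⟩)]
  · have hnot : ¬ ((x : ℝ) ^ θ < (q.1 : ℝ) ∧ (q.1 : ℝ) ≤ (x : ℝ) ^ θ' ∧ q.1 < q.2) :=
      fun h => hR h.2.1
    rw [if_neg hnot, zero_add]
    have hlt : (x : ℝ) ^ θ' < (q.1 : ℝ) := not_le.mp hR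
    by_cases hB : q.1 < q.2
    · rw [if_pos ⟨hpow.trans_lt hlt, hB⟩, if_pos ⟨hlt, hB⟩]
    · rw [if_neg (fun h => hB h.2), if_neg (fun h => hB h.2)]

/-- **The transfer** (card `split-mass-middle-prime`, TransferClaim ⇒; PROVED): the mass lemma and
middle-prime cancellation imply the crux. Given `θ` and `c > 0` choose
`θ′ := max (max ((θ+1)/2) (3/4)) (1 − c/(4C)) ∈ (θ, 1)`; then eventually
`|J_θ| ≤ |M_{θ,θ′}| + N_{θ′} ≤ (c/2)x + C(1−θ′)/(2θ′−1)·x ≤ (c/2)x + 2C(1−θ′)x ≤ c·x`. -/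
theorem transfer_holds : Transfer := by
  intro hmass hmid
  obtain ⟨C, hC, hmassC⟩ := hmass
  intro θ hθ hθ1
  show (fun x : ℕ => pairSum θ x) =o[atTop] fun x : ℕ => (x : ℝ)
  rw [Asymptotics.isLittleO_iff]
  intro c hc
  -- the auxiliary exponent θ'
  set θ' : ℝ := max (max ((θ + 1) / 2) (3 / 4)) (1 - c / (4 * C)) with hθ'_def
  have hθθ' : θ < θ' := by
    have h : θ < (θ + 1) / 2 := by linarith
    exact h.trans_le ((le_max_left _ _).trans (le_max_left _ _))
  have h34 : (3 : ℝ) / 4 ≤ θ' := (le_max_right _ _).trans (le_max_left _ _)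
  have hcC : 1 - c / (4 * C) ≤ θ' := le_max_right _ _
  have hθ'1 : θ' < 1 := by
    have h1 : (θ + 1) / 2 < 1 := by linarith
    have h2 : (3 : ℝ) / 4 < 1 := by norm_num
    have h3 : 1 - c / (4 * C) < 1 := by
      have : 0 < c / (4 * C) := by positivity
      linarith
    exact max_lt (max_lt h1 h2) h3
  have hθ'half : 1 / 2 < θ' := by linarith
  -- the two eventual bounds
  have hM := hmid θ θ' hθ hθθ' hθ'1
  rw [Asymptotics.isLittleO_iff] at hM
  have hM' := hM (half_pos hc)
  have hN := hmassC θ' hθ'half hθ'1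
  filter_upwards [hM', hN, Filter.eventually_ge_atTop 1] with x hxM hxN hx1
  have hxnn : (0 : ℝ) ≤ x := Nat.cast_nonneg x
  have hnorm : ‖(x : ℝ)‖ = x := Real.norm_natCast x
  rw [hnorm] at hxM ⊢
  -- constant bookkeeping: C (1-θ')/(2θ'-1) ≤ c/2
  have hC0 : C ≠ 0 := hC.ne'
  have hfrac : (1 - θ') / (2 * θ' - 1) ≤ 2 * (1 - θ') := by
    rw [div_le_iff₀ (by linarith)]
    nlinarith [mul_nonneg (sub_nonneg.mpr h34) (sub_nonneg.mpr hθ'1.le)]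
  have hconst : C * ((1 - θ') / (2 * θ' - 1)) ≤ c / 2 := by
    have h1 : 1 - θ' ≤ c / (4 * C) := by linarith
    calc C * ((1 - θ') / (2 * θ' - 1)) ≤ C * (2 * (1 - θ')) :=
          mul_le_mul_of_nonneg_left hfrac hC.le
      _ ≤ C * (2 * (c / (4 * C))) := by gcongr
      _ = c / 2 := by field_simp; ring
  rw [pairSum_eq_middleSum_add θ θ' x hx1 hθθ'.le]
  calc ‖middleSum θ θ' x + pairSum θ' x‖
      ≤ ‖middleSum θ θ' x‖ + ‖pairSum θ' x‖ := norm_add_le _ _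
    _ ≤ c / 2 * x + (splitMass θ' x : ℝ) := add_le_add hxM (norm_pairSum_le_splitMass θ' x)
    _ ≤ c / 2 * x + C * ((1 - θ') / (2 * θ' - 1)) * x := by linarith [hxN]
    _ ≤ c / 2 * x + c / 2 * x := by linarith [mul_le_mul_of_nonneg_right hconst hxnn]
    _ = c * x := by ring

/-! ### The composition: the two remaining stubs imply the crux, by name -/

/-- `SplitBlockJacobi` from the two open stubs (pure logic over the PROVED transfer and the two LANDED stubs;
no `sorry` outside the stubs): STUB 3 (`stub_pureDigitPiecesPow`, Type-I_χ digit pieces with a power saving)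
fed into STUB 4 (`stub_primalityCoupling`, the primality coupling) gives the factored cancellation; the LANDED
STUB 2 (`stub_digitReparametrisation`, p75842) turns it into `MiddlePrimeJacobi`; `transfer_holds` with the
LANDED STUB 1 (`stub_splitMassBound`, p75292) gives the crux. -/
theorem SplitBlockJacobi_of (h3 : Registered.stub_pureDigitPiecesPow)
    (h4 : Registered.stub_primalityCoupling) :
    Summit.Parity.BatemanHorn.Theses.IsogenyRedei.SplitBlockJacobi :=
  transfer_holds splitMassBound_holds (digitReparametrisation_holds (h4 h3))

/-- Wiring check: the registered stubs feed `SplitBlockJacobi_of` as stated. -/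
example : Summit.Parity.BatemanHorn.Theses.IsogenyRedei.SplitBlockJacobi :=
  SplitBlockJacobi_of stub_pureDigitPiecesPow stub_primalityCoupling

/-! ### Scratch checks of the `Leans on:` names and of the load-bearing hypothesis -/

/-- The sieve engine of STUB 1 resolves (beta upper-bound sieve for a sifting set `P ∣ P(z)`). -/
example := @Literature.NumberTheory.Sieve.SieveSequence.sifted_le_of_dvd_primesProdBelow

/-- The sifted sequence of STUB 1 resolves: values of an integer polynomial along an AP. -/
example := @Literature.NumberTheory.Sieve.polyAPSeq

/-- The `Σ ρ(m)/m` asymptotics of STUB 1 resolve. -/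
example := @Literature.NumberTheory.Sieve.RhoLogSums.abs_rhoLogSum_sub_le

/-- Reciprocity in the form used by STUB 2 resolves. -/
example := @jacobiSym.quadratic_reciprocity_one_mod_four

/-- Periodicity in the top argument used by STUB 2 (v) resolves. -/
example := @jacobiSym.mod_left

/-- Disproof §A honoured numerically: the constant of STUB 1 degenerates exactly at the load-bearing
endpoint `θ = 1/2` (where the disprover's secular term lives): `(1−θ)/(2θ−1)` has a pole there. -/
example : (2 : ℝ) * (1 / 2) - 1 = 0 := by norm_num

end Summit.Parity.BatemanHorn.Cruxes.SplitBlockJacobi.SplitMassMiddlePrime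

end
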